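import Summits.HodgeConjecture.CorCM.IndependentCMFieldsHodge
import Literature.AlgebraicGeometry.Pohlmann1968.CMTypeRankLowerBoundsNumberField
import Summits.HodgeConjecture.CorCM.Model.CMAbelianVarietyRealisedHolds
import HarnessLib

/-!
# Census: products of CM abelian varieties with CM by `ℚ(ζ₃)`, `ℚ(ζ₅)`, `ℚ(ζ₇)` — a CM elliptic curve, a simple CM
# abelian surface and a simple CM threefold whose fields act independently: every `E^a × S^b × T^c` satisfies the
# Hodge conjecture (kernel instance of `IndependentCMFieldsHodge`)

COR-CM (cell `pub-hodgecm2`), literature seat `lit-deligne-3` gen 4 (portfolio pass, 2026-08-21).  A finite,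
kernel-decided instance (no named fact, no `sorry`) of the proved theorems

* `Summit.HodgeConjecture.CorCM.hodgeConjectureFor_prod_of_coprime_cyclotomic` (`IndependentCMFieldsHodge`: for CM
  types `Φ_i` of cyclotomic fields `K_i ⊇ ℚ(ζ_{N_i})` of pairwise coprime levels, all NONDEGENERATE, every product
  `⨁_{j<M} A_{π j}` of realisations satisfies the Hodge conjecture — Gordon 1999 Thm. 7.5 (Murty–Hazama) + the
  independence mechanism of §3 Theorem (Imai–Murty) + Washington Prop. 2.4);
* `Literature.AlgebraicGeometry.Pohlmann1968.isNondegenerate_of_isPrimitive_of_finrank_le_six` (Ribet 1980 (3.7): a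
  primitive CM type of a CM field of degree `≤ 6` is nondegenerate);
* `Literature.AlgebraicGeometry.Pohlmann1968.Cyclotomic.isPrimitive_of_residues` (primitivity decided on residues).

THE FAMILY: three slots `three, five, seven` with levels `3, 5, 7` (pairwise coprime, `level_coprime`), fields `K_i` any
`N_i`-th cyclotomic extensions of `ℚ` (`[K_i:ℚ] = 2, 4, 6`), and the CM types cut out by the residue sets
`S_3 = {1} ⊂ (ℤ/3)ˣ`, `S_5 = {1, 2} ⊂ (ℤ/5)ˣ`, `S_7 = {1, 2, 3} ⊂ (ℤ/7)ˣ` (`Φ`): each is primitive (`isPrimitive_Φ`, the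
translates of `S_i` separate the units — `decide`), hence nondegenerate (`isNondegenerate_Φ`), so realisations are a CM
elliptic curve `E` (`j = 0`), a SIMPLE CM abelian surface `S` (e.g. the Jacobian of `y² = x⁵ + 1`) and a SIMPLE CM
threefold `T` (e.g. the Jacobian of `y² = x⁷ + 1`) (`isSimple_of_realisation`, `dim_eq_of_realisation`: dimensions
`1, 2, 3`).  RESULTS (for EVERY family of realisations `(A_i, ι_i, θ_i)`):

* `isNondegenerateFamily_Φ` — the family is nondegenerate: `rank Y(MT(E × S × T)) = 1 + 2 + 3 + 1 = 7`, i.e.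
  `E × S × T` is stably nondegenerate although its three CM fields are different;
* **`hodgeClassSpan_prod_eq_divisorClassesSpan`** — `Bᵐ ⊗ ℂ = Dᵐ ⊗ ℂ` on every product `⨁_{j<M} A_{π j}` (every
  `E^a × S^b × T^c`, any order of the factors);
* **`hodgeConjectureFor_prod`** — the Hodge conjecture for every such product, UNCONDITIONAL;
* `exists_curve_surface_threefold_hodgeConjecture_products` — with the tree's existence theorem for CM abelian
  varieties of prescribed type (`cmAbelianVarietyRealised_holds`, Shimura §6.2 Thm. 3): there exist a CM elliptic curve,
  a simple CM abelian surface and a simple CM abelian threefold all of whose products of powers satisfy the Hodge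
  conjecture.

## References

* [Gordon1999HodgeAVSurvey] B. B. Gordon, *A survey of the Hodge conjecture for abelian varieties*, §3 Theorem, 7.5, 10.10.
* [Ribet1980] K. Ribet, *Division fields of abelian varieties with complex multiplication*, §3 (3.7).
* [Washington1997] L. C. Washington, *Introduction to Cyclotomic Fields*, Prop. 2.4, Thm. 2.5.
* [Shimura1998] G. Shimura, *Abelian Varieties with Complex Multiplication and Modular Functions*, §6.2 Thm. 3, §8.2 Prop. 26.
-/

noncomputable section

open CategoryTheory CategoryTheory.Limits NumberField

namespace Summit.HodgeConjecture.CorCM.Census.CoprimeCyclotomicProducts357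

open Literature.NumberTheory.ComplexMultiplication
open Literature.AlgebraicGeometry.Motives (AbelianVariety CMType)
open Literature.AlgebraicGeometry.HodgeTheory
open Literature.AlgebraicGeometry.ComplexMultiplication (IsCMTypeRealisation)
open Literature.AlgebraicGeometry.VanGeemen1994 (hodgeClassSpan)
open Literature.AlgebraicGeometry.Pohlmann1968
open Literature.Barriers.HodgeConjecture (divisorClassesSpan)

/-! ### The three slots, their levels and residue sets -/

/-- The three slots of the census: CM by `ℚ(ζ₃)`, `ℚ(ζ₅)`, `ℚ(ζ₇)`. [folklore] -/
inductive Slot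
  | three
  | five
  | seven
  deriving DecidableEq, Fintype

/-- The census has a slot. [folklore] -/
instance : Nonempty Slot := ⟨Slot.three⟩

/-- The levels `3, 5, 7`. [folklore] -/
def level : Slot → ℕ
  | .three => 3
  | .five => 5
  | .seven => 7

/-- The levels are nonzero. [folklore] -/
instance instNeZeroLevel (i : Slot) : NeZero (level i) := ⟨by cases i <;> decide⟩

open scoped Function in
/-- **The levels `3, 5, 7` are pairwise coprime.** [folklore] -/
theorem level_coprime : Pairwise (Nat.Coprime on level) := by
  intro i j hij
  cases i <;> cases j <;> first | exact absurd rfl hij | decide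

/-- `2 < N_i` (so the fields are CM). [folklore] -/
theorem two_lt_level (i : Slot) : 2 < level i := by cases i <;> decide

/-- The units `(ℤ/N_i)ˣ` as explicit residue sets. [folklore] -/
def units : (i : Slot) → Finset (ZMod (level i))
  | .three => {1, 2}
  | .five => {1, 2, 3, 4}
  | .seven => {1, 2, 3, 4, 5, 6}

/-- The residue sets `S_3 = {1}`, `S_5 = {1, 2}`, `S_7 = {1, 2, 3}` cutting out the CM types. [cite: Gordon1999HodgeAVSurvey, §9.4.2] -/
def S : (i : Slot) → Finset (ZMod (level i))
  | .three => {1}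
  | .five => {1, 2}
  | .seven => {1, 2, 3}

/-- `units i` is exactly the set of residues prime to `N_i`. [folklore] -/
theorem coprime_iff_mem_units : ∀ (i : Slot) (c : ZMod (level i)), c.val.Coprime (level i) ↔ c ∈ units i := by
  intro i; cases i <;> decide

/-- `S_i` is a set of representatives of `(ℤ/N_i)ˣ/{±1}` (a CM type). [cite: Gordon1999HodgeAVSurvey, §9.4.2] -/
theorem S_cm : ∀ (i : Slot) (c : ZMod (level i)), c.val.Coprime (level i) → (c ∈ S i ↔ -c ∉ S i) := by
  intro i; cases i <;> decide

/-- The translates `u · S_i` separate the units (primitivity on residues). [cite: Shimura1998, §8.2 Prop. 26] -/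
theorem S_sep : ∀ (i : Slot), ∀ a ∈ units i, ∀ b ∈ units i, (∀ u ∈ units i, (u * a ∈ S i ↔ u * b ∈ S i)) → a = b := by
  intro i; cases i <;> decide

/-! ### The fields and the CM types -/

variable (K : Slot → Type) [∀ i, Field (K i)] [∀ i, NumberField (K i)]
  [∀ i, IsCyclotomicExtension {level i} ℚ (K i)]

/-- **The CM types `Φ_3, Φ_5, Φ_7`** of the `N_i`-th cyclotomic fields `K_i` cut out by `S_i` (`σ ∈ Φ_i ⟺ σ(ζ_{N_i}) =
e^{2πi c/N_i}`, `c ∈ S_i`). [cite: Gordon1999HodgeAVSurvey, §9.4.2] -/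
def Φ (i : Slot) : CMType (K i) := Cyclotomic.cmTypeOfResidues (N := level i) (L := K i) (S i) (S_cm i)

/-- `[K_i : ℚ] = φ(N_i)`. [cite: Washington1997, Thm. 2.5] -/
theorem finrank_eq (i : Slot) : Module.finrank ℚ (K i) = (level i).totient :=
  Cyclotomic.finrank_eq_totient (level i) (K i)

/-- `[K_i : ℚ] ≤ 6` (`= 2, 4, 6`). [cite: Washington1997, Thm. 2.5] -/
theorem finrank_le_six (i : Slot) : Module.finrank ℚ (K i) ≤ 6 := by
  rw [finrank_eq K i]
  cases i <;> decide

/-- The `K_i` are CM fields (`N_i > 2`). [folklore] -/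
theorem isCMField_K (i : Slot) : IsCMField (K i) :=
  IsCyclotomicExtension.Rat.isCMField (K i) (S := {level i}) ⟨level i, rfl, two_lt_level i⟩

/-- **Each `Φ_i` is primitive** (its realisations are SIMPLE: Shimura §8.2 Prop. 26). [cite: Shimura1998, §8.2 Prop. 26] -/
theorem isPrimitive_Φ (i : Slot) (φ₀ : K i →+* ℂ) : IsPrimitive (ℂ ≃+* ℂ) (Φ K i).1 φ₀ :=
  Cyclotomic.isPrimitive_of_residues (units i) (coprime_iff_mem_units i) (S_sep i) φ₀

/-- **Each `Φ_i` is nondegenerate** (Ribet: primitive of degree `≤ 6`; ranks `2, 3, 4`). [cite: Ribet1980, §3 Examples (3.7) (p. 87)] -/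
theorem isNondegenerate_Φ (i : Slot) : IsNondegenerate (Φ K i) := by
  haveI := isCMField_K K i
  obtain ⟨φ₀⟩ := (inferInstance : Nonempty (K i →+* ℂ))
  exact isNondegenerate_of_isPrimitive_of_finrank_le_six (Φ K i) (finrank_le_six K i) φ₀ (isPrimitive_Φ K i φ₀)

/-- **The family `(Φ_3, Φ_5, Φ_7)` is nondegenerate** (`rank Y(MT(E × S × T)) = 1 + 2 + 3 + 1`): the levels are
coprime, so the Galois actions on the three embedding sets are independent and the rank is additive.
[cite: Gordon1999HodgeAVSurvey, §3 Theorem and 7.5] [cite: Washington1997, Prop. 2.4] -/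
theorem isNondegenerateFamily_Φ : CMAlgebra.IsNondegenerateFamily (Φ K) := by
  haveI : ∀ i, IsCMField (K i) := isCMField_K K
  exact (isNondegenerateFamily_iff_of_coprime_cyclotomic level level_coprime (Φ K)).2 (isNondegenerate_Φ K)

/-! ### Realisations: a CM elliptic curve, a simple CM surface, a simple CM threefold, and all their products -/

variable {K}
variable {A : Slot → AbelianVariety ℂ} {ι : ∀ i, 𝓞 (K i) →+* End (A i)}
  {θ : ∀ i, K i →+* Module.End ℂ (complexBetti (A i).X 1)}

/-- `dim A_i = φ(N_i)/2 = 1, 2, 3`. [cite: Shimura1998, §6.2 Theorem 3] -/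
theorem dim_eq_of_realisation (hA : ∀ i, IsCMTypeRealisation (Φ K i) (A i) (ι i) (θ i)) (i : Slot) :
    (A i).dim = (level i).totient / 2 :=
  Cyclotomic.dim_eq_of_realisation (N := level i) (hA i)

/-- The realisation of `Φ_3` is an elliptic curve, of `Φ_5` a surface, of `Φ_7` a threefold. [cite: Shimura1998, §6.2 Theorem 3] -/
theorem dim_eq (hA : ∀ i, IsCMTypeRealisation (Φ K i) (A i) (ι i) (θ i)) :
    (A .three).dim = 1 ∧ (A .five).dim = 2 ∧ (A .seven).dim = 3 := by
  refine ⟨?_, ?_, ?_⟩ <;> rw [dim_eq_of_realisation hA] <;> decide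

/-- Every realisation of `Φ_i` is SIMPLE. [cite: Shimura1998, §8.2 Prop. 26] -/
theorem isSimple_of_realisation (hA : ∀ i, IsCMTypeRealisation (Φ K i) (A i) (ι i) (θ i)) (i : Slot) :
    (A i).IsSimple :=
  Cyclotomic.isSimple_of_residues (units i) (coprime_iff_mem_units i) (S_sep i) (hA i)

/-- **`Bᵐ ⊗ ℂ = Dᵐ ⊗ ℂ` on every product `⨁_{j<M} A_{π j}` — every `E^a × S^b × T^c` in any order — of realisations of
`(Φ_3, Φ_5, Φ_7)`.** [cite: Gordon1999HodgeAVSurvey, §3 Theorem (2) and 7.5] -/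
theorem hodgeClassSpan_prod_eq_divisorClassesSpan (hA : ∀ i, IsCMTypeRealisation (Φ K i) (A i) (ι i) (θ i))
    {M : ℕ} (π : Fin M → Slot) (m : ℕ) :
    hodgeClassSpan (⨁ fun j : Fin M => A (π j)).dim (⨁ fun j : Fin M => A (π j)).X m =
      divisorClassesSpan (⨁ fun j : Fin M => A (π j)).X (⨁ fun j : Fin M => A (π j)).dim m := by
  haveI : ∀ i, IsCMField (K i) := isCMField_K K
  exact hodgeClassSpan_prod_eq_divisorClassesSpan_of_coprime_cyclotomic level level_coprime (isNondegenerate_Φ K) hA π m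

/-- **The Hodge conjecture for every product `⨁_{j<M} A_{π j}` — every `E^a × S^b × T^c` — of realisations of
`(Φ_3, Φ_5, Φ_7)`: a CM elliptic curve, a simple CM abelian surface and a simple CM threefold with CM by `ℚ(ζ₃)`,
`ℚ(ζ₅)`, `ℚ(ζ₇)`**, UNCONDITIONAL. [cite: Gordon1999HodgeAVSurvey, §3 Theorem and 10.10] -/
theorem hodgeConjectureFor_prod (hA : ∀ i, IsCMTypeRealisation (Φ K i) (A i) (ι i) (θ i)) {M : ℕ}
    (π : Fin M → Slot) : HodgeConjectureFor (⨁ fun j : Fin M => A (π j)).dim (⨁ fun j : Fin M => A (π j)).X := by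
  haveI : ∀ i, IsCMField (K i) := isCMField_K K
  exact hodgeConjectureFor_prod_of_coprime_cyclotomic level level_coprime (isNondegenerate_Φ K) hA π

/-! ### Existence (Shimura §6.2 Thm. 3 in the tree: `cmAbelianVarietyRealised_holds`) -/

/-- **There exist a CM elliptic curve `E`, a simple CM abelian surface `S` and a simple CM abelian threefold `T` (with CM by
`ℚ(ζ₃)`, `ℚ(ζ₅)`, `ℚ(ζ₇)`) such that EVERY product `⨁_{j<M} X_{π j}` of copies of them — every `E^a × S^b × T^c` —
satisfies the Hodge conjecture**, unconditionally. [cite: Shimura1998, §6.2 Theorem 3] [cite: Gordon1999HodgeAVSurvey, 10.10] -/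
theorem exists_curve_surface_threefold_hodgeConjecture_products :
    ∃ X : Slot → AbelianVariety ℂ, (X .three).dim = 1 ∧ (X .five).dim = 2 ∧ (X .seven).dim = 3 ∧
      (∀ i, (X i).IsSimple) ∧
      ∀ (M : ℕ) (π : Fin M → Slot), HodgeConjectureFor (⨁ fun j : Fin M => X (π j)).dim (⨁ fun j : Fin M => X (π j)).X := by
  haveI hcyc : ∀ i, IsCyclotomicExtension {level i} ℚ (CyclotomicField (level i) ℚ) := fun i =>
    CyclotomicField.isCyclotomicExtension (level i) ℚ
  haveI hnf : ∀ i, NumberField (CyclotomicField (level i) ℚ) := fun i =>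
    IsCyclotomicExtension.numberField {level i} ℚ _
  haveI hcm : ∀ i, IsCMField (CyclotomicField (level i) ℚ) := isCMField_K fun i => CyclotomicField (level i) ℚ
  choose A ι θ hA using fun i : Slot =>
    cmAbelianVarietyRealised_holds (CyclotomicField (level i) ℚ) (Φ (fun i => CyclotomicField (level i) ℚ) i)
  have hA' : ∀ i, IsCMTypeRealisation (Φ (fun i => CyclotomicField (level i) ℚ) i) (A i) (ι i) (θ i) := fun i => hA i
  obtain ⟨h3, h5, h7⟩ := dim_eq hA'
  exact ⟨A, h3, h5, h7, isSimple_of_realisation hA', fun M π => hodgeConjectureFor_prod hA' π⟩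

end Summit.HodgeConjecture.CorCM.Census.CoprimeCyclotomicProducts357

end
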